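import Summits.BirchSwinnertonDyer.Rank1Residual.O6.X3WildTorsionFreeKatoBound
import Summits.BirchSwinnertonDyer.Rank1Residual.Additive.X4RankZeroTamagawaParity
import Literature.NumberTheory.EllipticCurves.Rank1Residual.Typed.CasselsLowerBound
import HarnessLib

/-!
# O6 / X3, rank 0: Kato's MEMBER bound (T-X3K), its parity sharpening (T-X3K♯), the residual (I-X3t)♭, the export (Kμ-K)
# — TYPED TARGETS, and the KERNEL ROUTE T-X3K ⟹ T-X3K♯ (Cassels transport + Cassels–Tate parity), PROVED
(cell `b2b-bsdres`, lane CLASS-CLOSURE, class O6 §3.4 ∩ X3; planner o6-r1 GEN 21 — memo `HOME/b2b-bsdres-o6-r1/gen21/O6-GEN21.md`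
 (sha16 `4924ab07e53b1f04`) §1–§4, typed sketch `gen21/lean/O6X3KatoMember.lean` (sha16 `3e9089410ed39c5e`; `lean check` rc 0 by the
 planner); `cells/o5o6/TARGETS.md` §O6 (G21-1)–(G21-5); INBOX 2026-08-22T09:00Z l.10823 ask (b) "cc-typer → place the four decls (slot:
 O6Targets §2 next to `X3WildOfKMC`; for r0 they REPLACE the KMC-shaped X3 slot)"; typer of record cc-typer-5 GEN 15; 0 Literature facts.
 PLACEMENT: a sibling of `O6Targets.lean` (350 l.; `lint.size`) and of GEN 14's `X3WildTorsionFreeKatoBound.lean` (R♮ shape, (I-X3•), R₀•),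
 whose vocabulary and Cassels class transport it reuses by name.)

HONEST FRAMING (cell `b2b-bsdres`, run/shared/lean/b2b/bsd-rank1-residual/, verbatim in every file): the goal of the cell is
to DELETE the COMBINATION-SHAPED residual classes of the Birch–Swinnerton-Dyer formula for ALL analytic-rank `≤ 1` elliptic
curves over `ℚ` — "full BSD formula for every rank `≤ 1` curve in class `C`" assembled STRICTLY from published theorems — so that
the rank-`≤ 1` remainder becomes exactly the CONSTRUCTION-SHAPED classes, which are TYPED (missing-input `Prop`s), NOT attempted.
This is not "finishing BSD". Lane CLASS-CLOSURE: research routes; census output is EVIDENCE / conjecture items, never a Literature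
fact; no main conjecture inside any certificate; nothing is booked; no mark of `RESIDUAL-MAP.md` moves; O6 and X3 stay OPEN.

THE FINDING (o6-r1 GEN 21; supersedes GEN 20's conjecture (I-X3•) = `ZetaIntegralityTorsionFreeThree`, which stays in the tree
as typed but is RETIRED as a line of attack).  For `E/ℚ`, `p` odd, ADDITIVE POTENTIALLY GOOD at `p`, `L(E,1) ≠ 0`, `E[p]` REDUCIBLE:
let `W_K` be KATO'S MEMBER of the isogeny class, DEFINED by `T_pW_K ≅ V_{ℤ_p}(f)(1)` as `G_ℚ`-lattices (Kato, Astérisque 295,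
8.3 p. 181 / 17.5 p. 274 "`T = (T_pE)(−1)`"; such a member exists — Silverman AEC III.4.12 / Rem. 4.13.2 — unique up to prime-to-`p`
isogeny; computable description: the member whose complex lattice is HOMOTHETIC to the period lattice `𝓛_f`; the identification is
reduction-free by Wuthrich 2014 Lemma 12 / Lemma 14 / the comparison sentences inside the proof of Prop. 8 — NOT by [W] §3 / Thm 4 /
`E•`, which are semistable-odd-`p` only (lit-kato GEN 30 W-2): the symbol `E•` is RETIRED on this additive cell; write `E_𝓛`, not
claimed to be Wuthrich's `E•`).  Kato's Thm. 12.6 (p. 222: `Z ⊂ Z(f,T)` of FINITE INDEX for `T = V_{𝒪_λ}(f)`, NO image hypothesis)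
read in the reflexive hull (Kato 13.14 sentences 1–2, p. 234 = Wuthrich Lemma 12) gives the integrality exponent `e_{W_K} ≥ 0`;
Wuthrich's Lemma 14 (p. 396: a `p`-isogeny ⇒ the fine Selmer dual is finitely generated over `ℤ_p`) gives `μ = 0`; the image-free reading R♮ of Kato 12.5 (3) / (14.14) / 14.15 / 14.16 (2)
(GEN 20, AUDITED by lit-kato GEN 26) then yields **T-X3K: `ord_p #Ш(W_K)[p^∞] ≤ ord_p #Ш_an(W_K) + t(W_K)`**, `t(W) := ord_p #W(ℚ)_tors`.
By Cassels' isogeny invariance `δ_p := ord_p #Ш(W) − ord_p #Ш_an(W)` is class-constant, so `δ_p ≤ t(W_K)`; `#Ш(W)` is a SQUARE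
(Cassels–Tate) and `ord_p #Ш_an(W)` is EVEN on every census member (exact modular-symbol value — a per-curve DECIDABLE certificate,
not a theorem), so `t(W_K) ≤ 1` already forces `δ_p ≤ 0`: **T-X3K♯**, the Euler-system HALF of `BSD(E,p)` on the whole class, and
the full `p`-part whenever some member has `p ∤ #Ш_an`.  For `p ≥ 5`, `t ≤ 1` is automatic (Mazur).

WHAT IS TYPED (§1; decl BODIES byte-identical to the planner's sketch; docstrings = the planner's + typer's `[evidence]` lines):
* `KatoMemberShaBoundOfReducible` — **T-X3K** (THEOREM-CANDIDATE — lit-kato AUD-9 / 11 / 12 / 13 PASS, GEN 30,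
  `KATO-PAGE-READ-gen30.md` 7af21c871af5fc77: every antecedent printed; EVIDENCE-labelled `@[conjecture]` until a TREE PROOF): `∃ W'` isogenous (Kato's member) with `ord Ш(W') + ord Tam(W') ≤ ord(L/Ω_{W'}) + 3 t(W')` — A161″'s conclusion
  (`Kato2004.rankZero_padicValNat_sha_add_padicValNat_tamagawa_le_of_additive_potGood_of_imageContainsSL2`) with
  `ImageContainsSL2` replaced by reducibility, at the member.  Typed `@[conjecture]` (nothing is a theorem until proved).
* `X3PotGoodRankZeroUpperOfSmallClassTorsion` — **T-X3K♯** (census-facing): no `ℤ/p²`-torsion in the class + `ord_p #Ш_an(W)`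
  even ⇒ `MissingUpperBoundAt W p`.  **PROVED BELOW from T-X3K** (§3) — so its only non-printed input is T-X3K itself.
* `X3PotGoodRankZeroUpperOfLargeClassTorsion` — **(I-X3t)♭**, the RESIDUAL CONJECTURE on classes WITH a `ℤ/p²` member (at `p = 3`:
  54b, 1890r, 122094bl of 9 476 X3∧O6∧r0 classes; 54b / 1890r closed at evidence level by C-X3K-2: `W_K` = 54b1 / 1890r1, `t = 1`).
* `X4UpperOfFineMuZero FineMuZero` — **(Kμ-K)**, cross-class export to X4 ∧ ¬(12.5.2) (owner n1011 image strand / O8): A161″'s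
  conclusion from `E[p]` irreducible + `μ(Y(E)) = 0` (Coates–Sujatha Conjecture A; interface `FineMuZero`).  Conditional target.
* §2 the planner's two PROVED bookkeeping theorems (`x4UpperOfFineMuZero_restrict_of_kato`: on (12.5.2) rows the export is A161″;
  `missingUpperBoundAt_of_small_or_large`: T-X3K♯ ∧ (I-X3t)♭ cover every X3 ∧ pot-good ∧ r0 pair with even `ord_p #Ш_an`).
* §3 **THE KERNEL ROUTE, PROVED** (memo §2 "~40 lines over existing facts once T-X3K is a named decl"):
  `x3PotGoodRankZeroUpperOfSmallClassTorsion_of_katoMember` — **T-X3K ⟹ T-X3K♯** granted the PUBLISHED named facts Cassels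
  (`bsdRHS_eq_of_isIsogenous`), Cassels–Tate (`exists_casselsTate_pairing`, via `isSquare_shaOrder_of_casselsTate`), GZK
  (`rank_eq_analyticRank_of_analyticRank_le_one`) and modularity (`hasEntireLFunction_rat`): at Kato's member the A161″-currency
  inequality is `ord_p #Ш(W') ≤ ord_p #Ш_an(W') + t(W') ≤ … + 1` (Miller currency `#Ш_an = q·#tors²/∏c`, `Reg = 1`,
  `L(W',s) = L(W,s)` proved in the tree); `TwistComparison.defectAgreeAt_of_isIsogenous` (Cassels) transports the defect to `W`;
  `ord_p #Ш(W)` even (square) and `ord_p #Ш_an(W)` even (hypothesis) absorb the odd slack.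
* READINGS (sibling file `O6/X3KatoMemberBoundReadings.lean`, theorems only; `lint.size`) at the X3-wild slot
  (`ClassX3 W 3 ∧ SubW W 3`, the binders of `O6Targets`' `X3WildOfKMC`; for `r0` these REPLACE the KMC-shaped slot — no main
  conjecture): the upper half from T-X3K♯ / from T-X3K; **full `BSD(W,p)` for EVERY member of a class having a member `W₀` with
  `p ∤ #Ш_an(W₀)`** (lower half trivial at `W₀`, Miller's `BSD(E,p)` transported by `TwistComparison.bsdp_of_bsdp_of_isIsogenous`)
  and **full `BSD(W,p)` from a finite LOWER certificate `p^{2k−1} ∣ #Ш(W₀)`, `ord_p #Ш_an(W₀) ≤ 2k`** (socket =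
  `Typed/CasselsLowerBound`'s `missingLowerBoundAt_of_casselsTate_of_pow_dvd`; the 144 all-`9 ∣ #Ш_an` classes, census ask C-X3K-3).
NOT typed (recorded): `W_K` itself (no `V_{ℤ_λ}(f)` / modular-symbol period lattice in the tree — T-X3K displays the member
existentially); "`ord_p #Ш_an` even" is a HYPOTHESIS fed per curve, never asserted; `t ≤ 1` automatic for `p ≥ 5` (Mazur's torsion
theorem is not in the tree — displayed); relation to GEN 14's R₀• (`X3WildTorsionFreeKatoBoundThree`): no implication either way is
claimed (R₀• is stated at the torsion-free member, T-X3K at Kato's member; C-X3K-2: they differ in 135/273 non-generic classes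
`N ≤ 10⁴`); T-X3K♯'s conclusions cover R₀•'s consumers (`X3WildRankZero.missingUpperBoundAt_of_isIsogenous_torsionFree`).
DEDUP (`lean search`): `KatoMemberShaBound`, `X3PotGoodRankZeroUpper`, `X4UpperOfFineMuZero`, `X3KatoMember` — no match; reused by
name: `MissingUpperBoundAt`, `MissingPPartAt`, `BSDp`, `shaAn`, `IsIsogenous`, `TwistComparison.defectAgreeAt_of_isIsogenous`,
`TwistComparison.bsdp_of_bsdp_of_isIsogenous`, `isSquare_shaOrder_of_casselsTate`, `missingLowerBoundAt_of_casselsTate_of_pow_dvd`,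
`ClassX3`, `SubW`, `Kato2004.ImageContainsSL2`, A161″, `Additive.padicValNat_le_one_of_not_sq_dvd` (harvest-2's
`X4RankZeroTamagawaParity.lean`, imported — gate `dedup.landed` on the typer's first dry-run).

EVIDENCE of record (o6-r1 GEN 21, memo §0 / §3; instrumentation only): census C-X3K-0 (`gen21/census_x3k.py` → `census_x3k.tsv`,
source `class-closure/O6/pairs.tsv` + ecdata): X3 ∧ O6 ∧ `r_an = 0` = 9 476 classes / 19 601 members, `t_max = 0`: 4 611, `= 1`: 4 862,
`= 2`: 3; `v₃(#Ш_an)` ∈ {0, 2, 4} on all 19 601 members (ODD: 0); 9 329 classes have a member with `3 ∤ #Ш_an`, 144 have all members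
`9 ∣ #Ш_an`.  C-X3K-2 (PARI `msfromell`, pre-registration `gen21/x3k2v3/X3K2-PREREG.md` sha256 `6c8e75f7…` BEFORE the production log;
calibrated 5/5 + '54a'→54b against Wuthrich p. 387; kit j155636 / j155929 / j156000 / j156005 PRODUCTION rc 0): 318/318 classes
`N ≤ 10⁴`, 697 members — P-X3K-1′ 318/318, P-X3K-2 0/697 failures, P-X3K-3 318/318, P-X3K-4 15/15; `t(W_K) = 1` in 135/273
non-generic classes; `W_K` ≅ a listed member in 318/318; the two computable `ℤ/9` classes have `W_K` = 54b1 / 1890r1 (`t = 1`).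
GEN 20's blind held-out EXT (j153812): LAW C 314/314, P-RED-2 102/102, P-RED-3 89/89.
PRESEARCH (typer, 2026-08-22; corpus + galaxy): "Kato Euler system reducible residual representation Selmer bound isogeny class
member" → nearest in print Wuthrich 2014 Thm 4 / §3 (the member `E•`, semistable integrality Thm 13), Kato 2004 Thm 12.6;
no printed T-X3K / T-X3K♯ at an additive prime — `presearch: T-X3K → none beyond the cited antecedents`.
References: K. Kato, Astérisque 295 (2004) Thm. 12.5, Thm. 12.6, 13.14, (14.14), Lemma 14.15, Thm. 14.5 (3), Lemma 14.7, Prop. 14.16 (2)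
[Kato2004Asterisque]; C. Wuthrich, Doc. Math. 19 (2014) §3, Lemma 12, Lemma 14 [Wuthrich2014]; J. Coates–R. Sujatha, Math. Ann. 331
(2005) Conj. A [CoatesSujatha2005]; J. W. S. Cassels, J. reine angew. Math. 217 (1965) [Cassels1965ArithmeticVIII]; J. S.
Milne, ADT Thm. I.7.3 [MilneADT2006]; J. H. Silverman, AEC Thm. X.4.14 [SilvermanAEC2009]; R. L. Miller, LMS J. Comput. Math. 14 (2011)
§1, Def. 1.1 [Miller2011LMS]; H. Darmon, CBMS 101 (2004) Thm. 3.22 [Darmon2004].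
-/

set_option autoImplicit false

noncomputable section

open scoped Classical

open WeierstrassCurve Literature.NumberTheory.EllipticCurves
  Literature.NumberTheory.EllipticCurves.Rank1Residual
  Literature.NumberTheory.EllipticCurves.Rank1Residual.Typed
  Summit.BirchSwinnertonDyer.Rank1Residual.Additive

namespace Summit.BirchSwinnertonDyer.Rank1Residual.O6

/-! ## §1 The four typed targets (o6-r1 GEN 21; decl bodies verbatim from `gen21/lean/O6X3KatoMember.lean`) -/

/-- **T-X3K (theorem-candidate; o6-r1 GEN 21): Kato's bound at Kato's member, up to its torsion.**
`E/ℚ` globally minimal, `p ≠ 2` a prime of ADDITIVE, POTENTIALLY GOOD reduction (`¬good ∧ ¬mult`,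
`0 ≤ v_p(j)`), `E[p]` REDUCIBLE, `L(E,1) ≠ 0`, `Ш(E)` finite. Then SOME curve `W'` `ℚ`-isogenous to `E`
(Kato's member `W_K`: `T_pW_K ≅ V_{ℤ_p}(f)(1)`) satisfies, with `L(W',1)/Ω_{W'} = q ∈ ℚ`,
`ord_p #Ш(W')[p^∞] + ord_p Tam(W') ≤ ord_p q + 3·ord_p #W'(ℚ)_tors`, i.e.
`ord_p #Ш(W') ≤ ord_p #Ш_an(W') + t(W')` (`#Ш_an = q·#tors²/Tam`).  With `t(W') = 0` this is exactly the
conclusion of the tree's A161″ `Kato2004.rankZero_padicValNat_sha_add_padicValNat_tamagawa_le_of_additive_potGood_of_imageContainsSL2`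
with `ImageContainsSL2` replaced by reducibility.  Antecedents (all printed): Kato 2004 Thm. 12.4, 12.5(1),(3),
Thm. 12.6, 13.12, 13.14, (14.14.1)–(14.14.2), Lemma 14.15, Prop. 14.16(2), 8.3, 17.5; Wuthrich 2014 Lemma 12 (= Kato 13.14
sentences 1–2, p. 234), Lemma 14 (p. 396) and the reduction-free comparison sentences in the proof of Prop. 8 (lit-kato W-2: NOT
[W] §3 / Thm 4 / `E•`, semistable-odd-`p` only; `W_K` is DEFINED by `T_pW_K ≅ V_{ℤ_p}(f)(1)`, exists by Silverman AEC III.4.12 /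
Rem. 4.13.2); Greenberg LNM 1716 Prop. 4.13 / §3.  NOT a fact; EVIDENCE-shaped
target; derivation = memo O6-GEN21.md §2 (audit items AUD-1…9).
TYPER (cc-typer-5 GEN 15): typed `@[conjecture]` — a THEOREM-CANDIDATE is not a theorem until proved / countersigned
— lit-kato AUD-9 / 11 / 12 / 13 PASS (GEN 30, `HOME/b2b-bsdres-lit-kato/gen30/KATO-PAGE-READ-gen30.md` 7af21c871af5fc77: Thm 12.6
scope p. 222 image-free; the twist transport is Kato's own 12.5 (1) / (14.13.1) / 14.14; AUD-12 in substance with W-2 above; AUD-13 the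
honest dependency note: the kernel route runs over the named facts `bsdRHS_eq_of_isIsogenous` + `exists_casselsTate_pairing`): every
antecedent printed; EVIDENCE-labelled `@[conjecture]` until a TREE PROOF;
`W_K` is displayed existentially (no period-lattice vocabulary in the tree).  Its census-facing consequence T-X3K♯ is
PROVED from it below (`x3PotGoodRankZeroUpperOfSmallClassTorsion_of_katoMember`).
[evidence: o6-r1 GEN 21 C-X3K-2 (PARI msfromell; prereg gen21/x3k2v3/X3K2-PREREG.md 6c8e75f7… before the production log; kit j156005 rc 0): W_K identified on 318/318 X3∧O6∧r0 classes N ≤ 10⁴ (697 members), P-X3K-1′ 318/318, P-X3K-2 0/697 failures, P-X3K-3 318/318, P-X3K-4 15/15, calibration 5/5 vs Wuthrich p. 387; W_K ≅ a listed member 318/318; t(W_K) = 1 in 135/273 non-generic classes — memo gen21/O6-GEN21.md 4924ab07e53b1f04 §3.3]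
[evidence: lit-kato GEN 30 audit KATO-PAGE-READ-gen30.md 7af21c871af5fc77 — AUD-9/11/12/13 PASS; o6-r1 kit j155636 / j155929 / j156000 / j156005 (C-X3K-2) + j153812 (GEN 20 EXT); census-lead intake C-X3K-2 requested, VALID word pending]
[cite: Kato2004Asterisque, Thm. 12.6 (p. 222), 13.14 sentences 1–2 (p. 234), 8.3 (p. 181), 17.5 (p. 274), Prop. 14.16 (2) (p. 244)]
[cite: Wuthrich2014, Lemma 12 (§3.3, pp. 394–395), Lemma 14 (p. 396)] [cite: SilvermanAEC2009, III.4.12 and Rem. III.4.13.2] -/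
@[conjecture] def KatoMemberShaBoundOfReducible : Prop :=
  ∀ (W : WeierstrassCurve ℚ) [W.IsElliptic] [W.IsGloballyMinimal] (p : ℕ) [Fact p.Prime],
    p ≠ 2 →
    ¬ W.HasGoodReductionAtPrime p → ¬ W.HasMultiplicativeReductionAtPrime p →
    0 ≤ padicValRat p W.j →
    ¬ W.HasIrreducibleModPGaloisRep p →
    W.entireLFunction 1 ≠ 0 → Finite W.sha →
    ∃ (W' : WeierstrassCurve ℚ) (_ : W'.IsElliptic) (_ : W'.IsGloballyMinimal),
      IsIsogenous W W' ∧ Finite W'.sha ∧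
      ∃ q : ℚ, W'.entireLFunction 1 / (W'.realPeriodRat : ℂ) = (q : ℂ) ∧
        (padicValNat p (Nat.card (AddCommGroup.primaryComponent W'.sha p)) : ℤ) +
            padicValNat p W'.tamagawaProduct ≤
          padicValRat p q + 3 * (padicValNat p W'.torsionOrder : ℤ)

/-- **T-X3K♯ (theorem-candidate; the census-facing form): the Euler-system half of `BSD(E,p)` on every
X3 ∧ potentially-good ∧ `r_an = 0` class whose members have `p² ∤ #tors`.**  Hypotheses as in T-X3K with
`r_an = 0`, plus: (i) no curve isogenous to `E` has a point of order `p²` (for `p ≥ 5` automatic; for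
`p = 3` it fails on exactly 3 of the 9 476 X3∧O6∧r0 classes: 54b, 1890r, 122094bl); (ii) `ord_p #Ш_an(E)`
is EVEN (decidable per curve from the exact modular-symbol value of `L(E,1)/Ω`; true on all 19 601 members
of the census).  Conclusion `Typed.MissingUpperBoundAt W p` (`ord_p #Ш ≤ ord_p #Ш_an`).  Kernel route from
T-X3K: Cassels' isogeny invariance of the BSD quotient (`bsdRHS_eq_of_isIsogenous`) transports
`ord_p #Ш − ord_p #Ш_an` from `W_K` to `W`; `#Ш[p^∞]` is a square (`exists_casselsTate_pairing`,
`isSquare_shaOrder_of_casselsTate`), so an odd slack `t(W_K) = 1` is absorbed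
(`two_mul_le_padicValNat_of_isSquare_of_pow_dvd`-type parity).  EVIDENCE-shaped target; nothing asserted.
TYPER (cc-typer-5 GEN 15): the kernel route IS PROVED in this file —
`x3PotGoodRankZeroUpperOfSmallClassTorsion_of_katoMember : KatoMemberShaBoundOfReducible → (Cassels) → (Cassels–Tate) →
(GZK) → (modularity) → X3PotGoodRankZeroUpperOfSmallClassTorsion`; the decl keeps its `@[conjecture]` tag because T-X3K is one.
REACH (EVIDENCE, memo §0/§2): the UPPER half on 9 473 / 9 476 X3∧O6∧r0 classes (19 592 / 19 601 pairs); full BSD₃ for every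
member of the 9 329 classes with a `3 ∤ #Ш_an` member (`X3WildRankZero.bsdp_of_isIsogenous_of_unit_member`, Readings file).
[evidence: o6-r1 GEN 21 C-X3K-0 (gen21/census_x3k.py → census_x3k.tsv from class-closure/O6/pairs.tsv + ecdata): 9 476 classes / 19 601 members; t_max = 0: 4 611, = 1: 4 862, = 2: 3; v₃(#Ш_an) ∈ {0,2,4} on 19 601/19 601 (odd: 0); memo gen21/O6-GEN21.md 4924ab07e53b1f04 §0]
[cite: Kato2004Asterisque, Thm. 12.6 (p. 222), Prop. 14.16 (2) (p. 244)] [cite: Wuthrich2014, Lemma 14 (p. 396)]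
[cite: Cassels1965ArithmeticVIII] [cite: MilneADT2006, Thm. I.7.3 and Remark I.7.4] [cite: SilvermanAEC2009, Thm. X.4.14] -/
@[conjecture] def X3PotGoodRankZeroUpperOfSmallClassTorsion : Prop :=
  ∀ (W : WeierstrassCurve ℚ) [W.IsElliptic] [W.IsGloballyMinimal] (p : ℕ) [Fact p.Prime],
    p ≠ 2 →
    ¬ W.HasGoodReductionAtPrime p → ¬ W.HasMultiplicativeReductionAtPrime p →
    0 ≤ padicValRat p W.j →
    ¬ W.HasIrreducibleModPGaloisRep p →
    W.analyticRank = 0 →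
    (∀ (W' : WeierstrassCurve ℚ) [W'.IsElliptic], IsIsogenous W W' → ¬ p ^ 2 ∣ W'.torsionOrder) →
    (∀ q : ℚ, shaAn W = (q : ℂ) → Even (padicValRat p q)) →
    MissingUpperBoundAt W p

/-- **(I-X3t)♭ — the RESIDUAL CONJECTURE of the line (o6-r1 GEN 21): the same upper bound on the classes
with a `ℤ/p²`-torsion member** (for `p = 3`: a `ℤ/9` member; X3∧O6∧r0 census: 54b, 1890r, 122094bl).
T-X3K only gives `ord_p #Ш ≤ ord_p #Ш_an + 2` there unless Kato's member is not the `ℤ/9` curve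
(instrument C-X3K-2 decides which member is `W_K`); the missing input is `μ(λ_{W_K}) ≥ t(W_K)`
(divisibility of Kato's `Λ`-adic zeta element in the reflexive hull by `p^{t(W_K)}`), predicted by BSD.
OPEN; nothing asserted.
TYPER (cc-typer-5 GEN 15): GENUINE CONJECTURE, EVIDENCE-labelled; at evidence level C-X3K-2 reads `W_K` = 54b1 / 1890r1 with
`t(W_K) = 1` on the two computable classes (so T-X3K + parity already give the bound there); 122094bl (`N` too large for
`msinit`) is the one class left on this conjecture at `p = 3`.
[evidence: o6-r1 GEN 21 C-X3K-2 verdicts on the ℤ/9 classes: 54b → W_K = 54b1 (t = 1; 𝓛_f = ⅓L(54b1)), 1890r → W_K = 1890r1 (t = 1; S_W = L_W exactly); 122094bl not computed — memo gen21/O6-GEN21.md 4924ab07e53b1f04 §3.3]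
[cite: Kato2004Asterisque, Conj. 12.10 (p. 224), Prop. 14.16 (2) (p. 244)] -/
@[conjecture] def X3PotGoodRankZeroUpperOfLargeClassTorsion : Prop :=
  ∀ (W : WeierstrassCurve ℚ) [W.IsElliptic] [W.IsGloballyMinimal] (p : ℕ) [Fact p.Prime],
    p ≠ 2 →
    ¬ W.HasGoodReductionAtPrime p → ¬ W.HasMultiplicativeReductionAtPrime p →
    0 ≤ padicValRat p W.j →
    ¬ W.HasIrreducibleModPGaloisRep p →
    W.analyticRank = 0 →
    (∃ (W' : WeierstrassCurve ℚ) (_ : W'.IsElliptic), IsIsogenous W W' ∧ p ^ 2 ∣ W'.torsionOrder) →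
    (∀ q : ℚ, shaAn W = (q : ℂ) → Even (padicValRat p q)) →
    MissingUpperBoundAt W p

/-- **(Kμ-K) — cross-class export to X4 ∧ ¬(12.5.2) (o6-r1 GEN 21; owner n1011 / image strand):
Kato's A161″ conclusion with `ImageContainsSL2` replaced by `E[p]` IRREDUCIBLE + `μ = 0` for the fine
Selmer group over `ℚ(μ_{p^∞})` (Coates–Sujatha Conjecture A at `p`, interface `FineMuZero`).**
Reason: for irreducible `E[p]` all stable lattices of `V_pE` are homothetic (anchor: the tree THEOREM
`Kato2004.exists_galoisStable_rationalTateSubmodule_eq_range_smul_subtype` — the residually-irreducible homothety; Kato's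
Lemma 14.7 (p. 238) is the 'almost all λ / SL₂ ⊂ image' version — lit-kato N-3), so `T_pE` IS Kato's lattice
up to scaling and Thm. 12.6 + the hull reading give `e_E ≥ 0` with NO image hypothesis; the only input of
Kato's 12.5(4) that genuinely used (12.5.2) is then `μ(𝐇²(T)⁰) = 0`, which is `μ(Y(E)) = 0` up to finitely
generated ℤ_p local terms (memo AUD-4).  CONDITIONAL target over the interface; nothing asserted.
TYPER (cc-typer-5 GEN 15): INTENDED BINDING of `FineMuZero W p`: "the Pontryagin dual `Y(E/ℚ(μ_{p^∞}))` of the fine Selmer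
group of `E[p^∞]` over `ℚ(μ_{p^∞})` is a finitely generated `ℤ_p`-module (`μ = 0`)" — Coates–Sujatha Conjecture A; no tree
vocabulary (no fine Selmer group over the cyclotomic tower); `fun _ _ => True` is NOT a legitimate binding.  Owner of record for
consumers: n1011 image strand / O8 (cc-typer-1's axis); typed here once, shared, not a second statement.  Bib: the planner's
key `CoatesSujatha2005FineSelmer` is registered as `CoatesSujatha2005` (Math. Ann. 331 (2005) 809–839, doi 10.1007/s00208-004-0609-z).
[cite: Kato2004Asterisque, Thm. 12.6 (p. 222), Lemma 14.7 (p. 238), Prop. 14.16 (2) (p. 244)]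
[cite: CoatesSujatha2005, Conjecture A] -/
@[conjecture] def X4UpperOfFineMuZero
    (FineMuZero : ∀ (W : WeierstrassCurve ℚ) [W.IsElliptic], ℕ → Prop) : Prop :=
  ∀ (W : WeierstrassCurve ℚ) [W.IsElliptic] [W.IsGloballyMinimal] (p : ℕ) [Fact p.Prime],
    p ≠ 2 →
    ¬ W.HasGoodReductionAtPrime p → ¬ W.HasMultiplicativeReductionAtPrime p →
    0 ≤ padicValRat p W.j →
    W.HasIrreducibleModPGaloisRep p → FineMuZero W p →
    W.entireLFunction 1 ≠ 0 → Finite W.sha →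
    ∃ q : ℚ, W.entireLFunction 1 / (W.realPeriodRat : ℂ) = (q : ℂ) ∧
      (padicValNat p (Nat.card (AddCommGroup.primaryComponent W.sha p)) : ℤ) +
          padicValNat p W.tamagawaProduct ≤ padicValRat p q

/-! ## §2 Bookkeeping checks (kernel; o6-r1 GEN 21 verbatim): the export (Kμ-K) is implied by A161″ on the (12.5.2) rows, and
T-X3K♯ ∧ (I-X3t)♭ cover every X3 ∧ pot-good ∧ r0 pair with even `ord_p #Ш_an`. -/

/-- On the rows WITH Kato's (12.5.2) the export is the tree's A161″ (sanity: the new target is not weaker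
than print there). [cite: Kato2004Asterisque, Thm. 14.5 (3) (p. 236)] -/
theorem x4UpperOfFineMuZero_restrict_of_kato
    (FineMuZero : ∀ (W : WeierstrassCurve ℚ) [W.IsElliptic], ℕ → Prop)
    (hKato : Kato2004.rankZero_padicValNat_sha_add_padicValNat_tamagawa_le_of_additive_potGood_of_imageContainsSL2)
    (W : WeierstrassCurve ℚ) [W.IsElliptic] [W.IsGloballyMinimal] (p : ℕ) [Fact p.Prime]
    (hp : p ≠ 2) (hg : ¬ W.HasGoodReductionAtPrime p) (hm : ¬ W.HasMultiplicativeReductionAtPrime p)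
    (hj : 0 ≤ padicValRat p W.j) (himg : Kato2004.ImageContainsSL2 W p) (_hμ : FineMuZero W p)
    (hL : W.entireLFunction 1 ≠ 0) (hfin : Finite W.sha) :
    ∃ q : ℚ, W.entireLFunction 1 / (W.realPeriodRat : ℂ) = (q : ℂ) ∧
      (padicValNat p (Nat.card (AddCommGroup.primaryComponent W.sha p)) : ℤ) +
          padicValNat p W.tamagawaProduct ≤ padicValRat p q :=
  hKato W p hp hg hm hj himg hL hfin

/-- T-X3K♯ and (I-X3t)♭ together give the upper half on every X3 ∧ pot-good ∧ r0 pair with even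
`ord_p #Ш_an` (case split on whether the class has a `ℤ/p²`-torsion member). Bookkeeping. [folklore] -/
theorem missingUpperBoundAt_of_small_or_large
    (hS : X3PotGoodRankZeroUpperOfSmallClassTorsion) (hL : X3PotGoodRankZeroUpperOfLargeClassTorsion)
    (W : WeierstrassCurve ℚ) [W.IsElliptic] [W.IsGloballyMinimal] (p : ℕ) [Fact p.Prime]
    (hp : p ≠ 2) (hg : ¬ W.HasGoodReductionAtPrime p) (hm : ¬ W.HasMultiplicativeReductionAtPrime p)
    (hj : 0 ≤ padicValRat p W.j) (hred : ¬ W.HasIrreducibleModPGaloisRep p) (hr : W.analyticRank = 0)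
    (heven : ∀ q : ℚ, shaAn W = (q : ℂ) → Even (padicValRat p q)) :
    MissingUpperBoundAt W p := by
  by_cases h : ∃ (W' : WeierstrassCurve ℚ) (_ : W'.IsElliptic), IsIsogenous W W' ∧ p ^ 2 ∣ W'.torsionOrder
  · exact hL W p hp hg hm hj hred hr h heven
  · refine hS W p hp hg hm hj hred hr ?_ heven
    intro W' _ hiso hdvd
    exact h ⟨W', ‹_›, hiso, hdvd⟩

/-! ## §3 THE KERNEL ROUTE, PROVED: T-X3K ⟹ T-X3K♯ (Cassels transport of the defect + Cassels–Tate parity) -/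

/-- The `p`-adic valuation of a nonzero perfect square is even. Elementary. [folklore] -/
theorem even_padicValNat_of_isSquare {p n : ℕ} [Fact p.Prime] (hsq : IsSquare n) (hn : n ≠ 0) :
    Even (padicValNat p n) := by
  obtain ⟨r, rfl⟩ := hsq
  have hr : r ≠ 0 := fun h => hn (by simp [h])
  rw [padicValNat.mul hr hr]
  exact ⟨_, rfl⟩

/-- **A161″-currency ⟹ Miller currency, with torsion slack.**  For `W'/ℚ` of analytic rank `0` with `Ш(W')` finite,
`L(W',1)/Ω_{W'} = q ∈ ℚ` and `ord_p #Ш(W')[p^∞] + v_p(∏ c_ℓ) ≤ ord_p q + 3·ord_p #W'(ℚ)_tors`, the analytic order of `Ш` is the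
rational `q' = q·#tors²/∏ c_ℓ` (`shaAn_def`; `Reg = 1` by GZK `hGZK`; `L(W',1) ≠ 0` by modularity `hmod`) and
`ord_p #Ш(W') ≤ ord_p q' + ord_p #W'(ℚ)_tors`.  Bookkeeping. [cite: Miller2011LMS, Def. 1.1 (arXiv:1010.2431 p. 3)]
[cite: Darmon2004, Thm. 3.22] -/
theorem exists_shaAn_le_add_torsion_of_katoCurrency (hGZK : rank_eq_analyticRank_of_analyticRank_le_one)
    (hmod : hasEntireLFunction_rat) (W' : WeierstrassCurve ℚ) [W'.IsElliptic] (p : ℕ) [Fact p.Prime]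
    (hr' : W'.analyticRank = 0) (hfin' : Finite W'.sha) {q : ℚ}
    (hq : W'.entireLFunction 1 / (W'.realPeriodRat : ℂ) = (q : ℂ))
    (hle : (padicValNat p (Nat.card (AddCommGroup.primaryComponent W'.sha p)) : ℤ) +
        padicValNat p W'.tamagawaProduct ≤ padicValRat p q + 3 * (padicValNat p W'.torsionOrder : ℤ)) :
    ∃ q' : ℚ, shaAn W' = (q' : ℂ) ∧
      (padicValNat p W'.shaOrder : ℤ) ≤ padicValRat p q' + (padicValNat p W'.torsionOrder : ℤ) := by
  haveI : Finite W'.sha := hfin'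
  obtain ⟨hmw', -⟩ := hGZK W' (by rw [hr']; exact zero_le_one)
  have hmw0' : W'.mordellWeilRank = 0 := by rw [hmw', hr']
  have hΩ : (W'.realPeriodRat : ℂ) ≠ 0 := by exact_mod_cast W'.realPeriodRat_pos_holds.ne'
  have hc0 : 0 < W'.tamagawaProduct := W'.tamagawaProduct_pos_holds
  have ht0 : 0 < W'.torsionOrder := W'.torsionOrder_pos_holds
  have hL' : W'.entireLFunction 1 ≠ 0 := (W'.analyticRank_eq_zero_iff_holds (hmod W')).mp hr'
  have hq0 : q ≠ 0 := by
    rintro rfl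
    rw [Rat.cast_zero, div_eq_zero_iff] at hq
    exact hq.elim hL' hΩ
  have ht : (W'.torsionOrder : ℚ) ≠ 0 := by exact_mod_cast ht0.ne'
  have hcq : (W'.tamagawaProduct : ℚ) ≠ 0 := by exact_mod_cast hc0.ne'
  refine ⟨q * (W'.torsionOrder : ℚ) ^ 2 / (W'.tamagawaProduct : ℚ), ?_, ?_⟩
  · have hLq : W'.entireLFunction 1 = (q : ℂ) * (W'.realPeriodRat : ℂ) := by
      rw [← hq, div_mul_cancel₀ _ hΩ]
    rw [shaAn_def, leadingLCoeff_eq_of_analyticRank_eq_zero W' hr', W'.regulator_eq_one_of_rank_zero hmw0', hLq]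
    push_cast
    field_simp
  · have hsha : padicValNat p (Nat.card (AddCommGroup.primaryComponent W'.sha p)) = padicValNat p W'.shaOrder := by
      unfold WeierstrassCurve.shaOrder
      exact padicValNat_card_addPrimaryComponent p
    have hv : padicValRat p (q * (W'.torsionOrder : ℚ) ^ 2 / (W'.tamagawaProduct : ℚ)) =
        padicValRat p q + 2 * (padicValNat p W'.torsionOrder : ℤ) - (padicValNat p W'.tamagawaProduct : ℤ) := by
      rw [padicValRat.div (mul_ne_zero hq0 (pow_ne_zero 2 ht)) hcq, padicValRat.mul hq0 (pow_ne_zero 2 ht), pow_two,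
        padicValRat.mul ht ht, padicValRat.of_nat, padicValRat.of_nat]
      ring
    rw [hv, ← hsha]
    linarith

/-- **THE KERNEL ROUTE T-X3K ⟹ T-X3K♯ (PROVED; o6-r1 GEN 21 memo §2).**  Granted the PUBLISHED named facts — Cassels' isogeny
invariance of the BSD quotient (`hCassels` = `WeierstrassCurve.bsdRHS_eq_of_isIsogenous`, Cassels 1965 / Milne ADT I.7.3), the
Cassels–Tate pairing (`hCT` = `exists_casselsTate_pairing`, Silverman AEC X.4.14: a finite `Ш` has square order), Gross–Zagier–
Kolyvagin (`hGZK`: `rank = r_an ≤ 1`, `Ш` finite) and modularity (`hmod`) — Kato's member bound T-X3K implies the census-facing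
upper half T-X3K♯.  Proof: at Kato's member `W' ∼ W` (from T-X3K at `W`; `L(W,1) ≠ 0` by modularity, `Ш(W)` finite by GZK),
`ord_p #Ш(W') ≤ ord_p #Ш_an(W') + t(W')` (`exists_shaAn_le_add_torsion_of_katoCurrency`; `r_an(W') = r_an(W) = 0` since
`L(W',s) = L(W,s)`, `analyticRank_eq_of_isIsogenous'`) with `t(W') ≤ 1` (no `ℤ/p²` in the class); Cassels transports the defect
`ord_p #Ш_an − ord_p #Ш` from `W'` to `W` (`TwistComparison.defectAgreeAt_of_isIsogenous`); `ord_p #Ш(W)` is even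
(`isSquare_shaOrder_of_casselsTate`) and `ord_p #Ш_an(W)` is even (hypothesis), so the slack `≤ 1` is `≤ 0`.  Nothing is
asserted about T-X3K. [cite: Cassels1965ArithmeticVIII] [cite: MilneADT2006, Thm. I.7.3 and Remark I.7.4]
[cite: SilvermanAEC2009, Thm. X.4.14] [cite: Miller2011LMS, §1 and Def. 1.1] [cite: Darmon2004, Thm. 3.22] -/
theorem x3PotGoodRankZeroUpperOfSmallClassTorsion_of_katoMember (hK : KatoMemberShaBoundOfReducible)
    (hCassels : bsdRHS_eq_of_isIsogenous) (hCT : exists_casselsTate_pairing (K := ℚ))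
    (hGZK : rank_eq_analyticRank_of_analyticRank_le_one) (hmod : hasEntireLFunction_rat) :
    X3PotGoodRankZeroUpperOfSmallClassTorsion := by
  intro W _ _ p _ hp hg hm hj hred hr hsmall heven
  -- `L(W,1) ≠ 0` (modularity) and `Ш(W)` finite (GZK)
  have hL : W.entireLFunction 1 ≠ 0 := (W.analyticRank_eq_zero_iff_holds (hmod W)).mp hr
  have hr1 : W.analyticRank ≤ 1 := by rw [hr]; exact zero_le_one
  have hfinW : W.ShaFinite := (hGZK W hr1).2
  -- Kato's member `W'`
  obtain ⟨W', hE', hM', hiso, hfin', q, hq, hle⟩ := hK W p hp hg hm hj hred hL hfinW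
  haveI := hE'
  haveI := hM'
  have hfin'S : W'.ShaFinite := hfin'
  have hr' : W'.analyticRank = 0 := by rw [← analyticRank_eq_of_isIsogenous' hiso, hr]
  -- Miller currency at `W'`, with the torsion slack `t(W') ≤ 1`
  obtain ⟨q', hq', hW'⟩ := exists_shaAn_le_add_torsion_of_katoCurrency hGZK hmod W' p hr' hfin' hq hle
  have ht1 : padicValNat p W'.torsionOrder ≤ 1 :=
    padicValNat_le_one_of_not_sq_dvd W'.torsionOrder_pos_holds.ne' (hsmall W' hiso)
  -- Cassels: transport the defect from `W'` to `W`
  obtain ⟨r, r', hr0, hrW, hδ⟩ :=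
    TwistComparison.defectAgreeAt_of_isIsogenous W' W p hCassels hmod hiso.symm_of_isElliptic hfin'S hq'
  have hrq : r = q' := by exact_mod_cast hr0.symm.trans hq'
  rw [hrq] at hδ
  -- parity at `W`
  have hsqW : IsSquare W.shaOrder := isSquare_shaOrder_of_casselsTate hCT W hfinW
  obtain ⟨a, ha⟩ := even_padicValNat_of_isSquare (p := p) hsqW (W.shaOrder_pos hfinW).ne'
  obtain ⟨b, hb⟩ := heven r' hrW
  refine ⟨r', hrW, ?_⟩
  have ht1' : ((padicValNat p W'.torsionOrder : ℕ) : ℤ) ≤ 1 := by exact_mod_cast ht1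
  have ha' : ((padicValNat p W.shaOrder : ℕ) : ℤ) = (a : ℤ) + (a : ℤ) := by exact_mod_cast ha
  omega

end Summit.BirchSwinnertonDyer.Rank1Residual.O6

end
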